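import Mathlib
import Literature.NumberTheory.LFunctions.SemimultiplicativeMoebiusTheorem
import Summits.QuantumAdvantage.QuantumAdvantage.Theorems.MobiusLadderQuadraticDigitPhasesStubCompactLemmas2

/-!
# Banded quadratic digit phases: the block statistic via Konieczny's dichotomy
(stub `stub_momoOfBranches`)

Crux `MobiusLadder.QuadraticDigitPhases` (stmt-QuantumAdvantage-1391), line `Sketch`, stub
`stub_momoOfBranches`.  For an infinite `s`-banded quadratic form `(quad, lin)` over `ZMod 2`
(`quad i j ≠ 0 → i < j ≤ i + s`) the real phase `φ(N) = (-1)^{Φ(N)}`,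
`Φ(N) = Σ_{i,j ≤ N} quad i j xᵢ xⱼ + Σ_{i ≤ N} lin i xᵢ` (`x` = binary digits of `N`), has dyadic block
statistic `Σ_b |Σ_{a<2^k} λ(2^k b + a) φ(2^k b + a)| ≤ ε 2^n` for `k`, then `n`, large — GIVEN the three
inputs of the Konieczny split as hypotheses: `hA` (almost periodic sequences have small block
statistic), `hK1` (quasimultiplicative Cesàro-null sequences have uniformly small aligned short block
sums) and `hK2` (pairwise short-block control of `f(p₁·) conj f(p₂·)` gives the block statistic).

Proof.  `f = φ : ℕ → ℂ` is unimodular and `2`-semimultiplicative with gap `≤ s`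
(`isSemimultiplicative_banded`): in Konieczny's identity `f(n+m+k) f(m) = f(n+m) f(m+k)` the digit
supports of `k ⊂ [0,l)`, `m ⊂ [l,l+s)`, `n ⊂ [l+s,∞)` are disjoint, so the digits add without carries
(`ind_add`), the second difference of the quadratic form is the sum of the cross terms
`quad i j (kᵢ nⱼ + nᵢ kⱼ)` (`form_add_add`), and these vanish by bandedness (`cross_eq_zero`).  Then the
tree's dichotomy (`Konieczny.isAlmostPeriodic_of_structured`, `Konieczny.tendsto_corr_swap`,
`Konieczny.gap_mono`, `Konieczny.isQuasimult_corr`): either some odd-prime-pair correlation is not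
Cesàro-null, so `f` is almost periodic and `hA` applies, or all are, so `hK1` feeds `hK2`.  Finally the
complex block statistic is cast back to the real one (`abs_block_eq_norm`).
-/

set_option linter.dupNamespace false -- D-0017: single-problem summit ⇒ QuantumAdvantage.QuantumAdvantage by design

namespace Summit.QuantumAdvantage.QuantumAdvantage.Theorems.MobiusLadderQuadraticDigitPhasesStubMomoOfBranches

open Finset Filter
open scoped ComplexConjugate
open Literature.NumberTheory.LFunctions
open Summit.QuantumAdvantage.QuantumAdvantage.Theorems.MobiusLadderQuadraticDigitPhasesStubCompact
  (bitForm_range_eq)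

/-! ## Digits of carry-free sums -/

/-- Carry-free addition: if `b < 2^i` and `2^i ∣ a`, the digit indicators of `a + b` are the sums of
those of `a` and of `b`. -/
theorem ind_add {a b i : ℕ} (hb : b < 2 ^ i) (ha : 2 ^ i ∣ a) (j : ℕ) :
    (if Nat.testBit (a + b) j then (1 : ZMod 2) else 0) =
      (if Nat.testBit a j then (1 : ZMod 2) else 0) + (if Nat.testBit b j then (1 : ZMod 2) else 0) := by
  obtain ⟨c, rfl⟩ := ha
  rw [Nat.testBit_two_pow_mul_add c hb, Nat.testBit_two_pow_mul]
  by_cases hj : j < i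
  · simp [hj, not_le.mpr hj]
  · have hbj : Nat.testBit b j = false :=
      Nat.testBit_lt_two_pow (hb.trans_le (Nat.pow_le_pow_right two_pos (not_lt.mp hj)))
    simp [hj, not_lt.mp hj, hbj]

/-- A number `< 2^l` has no digits at positions `≥ l`. -/
theorem ind_eq_zero_of_lt {k l i : ℕ} (hk : k < 2 ^ l) (hi : l ≤ i) :
    (if Nat.testBit k i then (1 : ZMod 2) else 0) = 0 := by
  simp [Nat.testBit_lt_two_pow (hk.trans_le (Nat.pow_le_pow_right two_pos hi))]

/-- A multiple of `2^l` has no digits below `l`. -/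
theorem ind_eq_zero_of_dvd {n l i : ℕ} (hn : 2 ^ l ∣ n) (hi : i < l) :
    (if Nat.testBit n i then (1 : ZMod 2) else 0) = 0 := by
  obtain ⟨c, rfl⟩ := hn
  simp [Nat.testBit_two_pow_mul, not_le.mpr hi]

/-- `N < 2^M` as soon as `N ≤ M`. -/
theorem lt_two_pow_of_le {N M : ℕ} (h : N ≤ M) : N < 2 ^ M :=
  Nat.lt_two_pow_self.trans_le (Nat.pow_le_pow_right two_pos h)

/-! ## The second difference of a quadratic form -/

/-- The second difference of a quadratic form `F(x) = Σ Q i j xᵢ xⱼ + Σ L i xᵢ` (window `T`):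
`F(u+v+w) + F(v) = F(u+v) + F(v+w) + Σ Q i j (uᵢ wⱼ + wᵢ uⱼ)`. -/
theorem form_add_add {R : Type*} [CommRing R] (T : Finset ℕ) (Q : ℕ → ℕ → R) (L : ℕ → R)
    (u v w : ℕ → R) :
    ((∑ i ∈ T, ∑ j ∈ T, Q i j * (u i + v i + w i) * (u j + v j + w j)) +
        ∑ i ∈ T, L i * (u i + v i + w i)) +
      ((∑ i ∈ T, ∑ j ∈ T, Q i j * v i * v j) + ∑ i ∈ T, L i * v i) =
    ((∑ i ∈ T, ∑ j ∈ T, Q i j * (u i + v i) * (u j + v j)) + ∑ i ∈ T, L i * (u i + v i)) +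
      ((∑ i ∈ T, ∑ j ∈ T, Q i j * (v i + w i) * (v j + w j)) + ∑ i ∈ T, L i * (v i + w i)) +
      ∑ i ∈ T, ∑ j ∈ T, Q i j * (u i * w j + w i * u j) := by
  have HQ : (∑ i ∈ T, ∑ j ∈ T, Q i j * (u i + v i + w i) * (u j + v j + w j)) +
      ∑ i ∈ T, ∑ j ∈ T, Q i j * v i * v j =
      (∑ i ∈ T, ∑ j ∈ T, Q i j * (u i + v i) * (u j + v j)) +
        (∑ i ∈ T, ∑ j ∈ T, Q i j * (v i + w i) * (v j + w j)) +
        ∑ i ∈ T, ∑ j ∈ T, Q i j * (u i * w j + w i * u j) := by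
    simp only [← Finset.sum_add_distrib]
    exact Finset.sum_congr rfl fun i _ => Finset.sum_congr rfl fun j _ => by ring
  have HL : (∑ i ∈ T, L i * (u i + v i + w i)) + ∑ i ∈ T, L i * v i =
      (∑ i ∈ T, L i * (u i + v i)) + ∑ i ∈ T, L i * (v i + w i) := by
    simp only [← Finset.sum_add_distrib]
    exact Finset.sum_congr rfl fun i _ => by ring
  linear_combination HQ + HL

/-- The cross terms vanish for an `s`-banded `Q` (`Q i j ≠ 0 → i < j ≤ i + s`) when `u` lives below `l`
and `w` at or above `l + s`. -/
theorem cross_eq_zero {R : Type*} [CommRing R] (T : Finset ℕ) (Q : ℕ → ℕ → R) {s l : ℕ}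
    (hQ : ∀ i j, Q i j ≠ 0 → i < j ∧ j ≤ i + s) (u w : ℕ → R) (hu : ∀ i, u i ≠ 0 → i < l)
    (hw : ∀ j, w j ≠ 0 → l + s ≤ j) :
    ∑ i ∈ T, ∑ j ∈ T, Q i j * (u i * w j + w i * u j) = 0 := by
  refine Finset.sum_eq_zero fun i _ => Finset.sum_eq_zero fun j _ => ?_
  by_cases hq : Q i j = 0
  · rw [hq, zero_mul]
  obtain ⟨hij, hjs⟩ := hQ i j hq
  have h1 : u i * w j = 0 := by
    by_contra h
    have := hu i (left_ne_zero_of_mul h)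
    have := hw j (right_ne_zero_of_mul h)
    omega
  have h2 : w i * u j = 0 := by
    by_contra h
    have := hw i (left_ne_zero_of_mul h)
    have := hu j (right_ne_zero_of_mul h)
    omega
  rw [h1, h2, add_zero, mul_zero]

/-- Konieczny's cocycle identity for the quadratic bit form of an `s`-banded `(quad, lin)` over a fixed
window `T`: for `k < 2^l`, `2^l ∣ m < 2^(l+s)`, `2^(l+s) ∣ n`,
`Φ_T(n+m+k) + Φ_T(m) = Φ_T(n+m) + Φ_T(m+k)`. -/
theorem form_cocycle (T : Finset ℕ) (quad : ℕ → ℕ → ZMod 2) (lin : ℕ → ZMod 2) {s : ℕ}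
    (hband : ∀ i j, quad i j ≠ 0 → i < j ∧ j ≤ i + s) {l n m k : ℕ} (hk : k < 2 ^ l)
    (hm : 2 ^ l ∣ m) (hms : m < 2 ^ (l + s)) (hn : 2 ^ (l + s) ∣ n) :
    ((∑ i ∈ T, ∑ j ∈ T, quad i j * (if Nat.testBit (n + m + k) i then (1 : ZMod 2) else 0) *
          (if Nat.testBit (n + m + k) j then (1 : ZMod 2) else 0)) +
        ∑ i ∈ T, lin i * (if Nat.testBit (n + m + k) i then (1 : ZMod 2) else 0)) +
      ((∑ i ∈ T, ∑ j ∈ T, quad i j * (if Nat.testBit m i then (1 : ZMod 2) else 0) *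
          (if Nat.testBit m j then (1 : ZMod 2) else 0)) +
        ∑ i ∈ T, lin i * (if Nat.testBit m i then (1 : ZMod 2) else 0)) =
    ((∑ i ∈ T, ∑ j ∈ T, quad i j * (if Nat.testBit (n + m) i then (1 : ZMod 2) else 0) *
          (if Nat.testBit (n + m) j then (1 : ZMod 2) else 0)) +
        ∑ i ∈ T, lin i * (if Nat.testBit (n + m) i then (1 : ZMod 2) else 0)) +
      ((∑ i ∈ T, ∑ j ∈ T, quad i j * (if Nat.testBit (m + k) i then (1 : ZMod 2) else 0) *
          (if Nat.testBit (m + k) j then (1 : ZMod 2) else 0)) +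
        ∑ i ∈ T, lin i * (if Nat.testBit (m + k) i then (1 : ZMod 2) else 0)) := by
  -- no carries: `m + k < 2^(l+s)`
  have hmk : m + k < 2 ^ (l + s) := by
    obtain ⟨c, rfl⟩ := hm
    have hc : c < 2 ^ s := by
      rw [pow_add] at hms
      exact Nat.lt_of_mul_lt_mul_left hms
    calc 2 ^ l * c + k < 2 ^ l * c + 2 ^ l := by omega
      _ = 2 ^ l * (c + 1) := by ring
      _ ≤ 2 ^ l * 2 ^ s := Nat.mul_le_mul_left _ hc
      _ = 2 ^ (l + s) := by rw [pow_add]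
  have e1 : ∀ i, (if Nat.testBit (m + k) i then (1 : ZMod 2) else 0) =
      (if Nat.testBit k i then (1 : ZMod 2) else 0) + (if Nat.testBit m i then (1 : ZMod 2) else 0) :=
    fun i => by rw [ind_add hk hm i, add_comm]
  have e2 : ∀ i, (if Nat.testBit (n + m) i then (1 : ZMod 2) else 0) =
      (if Nat.testBit m i then (1 : ZMod 2) else 0) + (if Nat.testBit n i then (1 : ZMod 2) else 0) :=
    fun i => by rw [ind_add hms hn i, add_comm]
  have e3 : ∀ i, (if Nat.testBit (n + m + k) i then (1 : ZMod 2) else 0) =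
      (if Nat.testBit k i then (1 : ZMod 2) else 0) + (if Nat.testBit m i then (1 : ZMod 2) else 0) +
        (if Nat.testBit n i then (1 : ZMod 2) else 0) := fun i => by
    rw [add_assoc, ind_add hmk hn i, ind_add hk hm i]; ring
  simp_rw [e3, e2, e1]
  have h := form_add_add T quad lin (fun i => if Nat.testBit k i then (1 : ZMod 2) else 0)
    (fun i => if Nat.testBit m i then (1 : ZMod 2) else 0)
    (fun i => if Nat.testBit n i then (1 : ZMod 2) else 0)
  have hc := cross_eq_zero T quad (l := l) hband (fun i => if Nat.testBit k i then (1 : ZMod 2) else 0)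
    (fun i => if Nat.testBit n i then (1 : ZMod 2) else 0)
    (fun i hi => by
      by_contra hil
      exact hi (ind_eq_zero_of_lt hk (not_lt.mp hil)))
    (fun j hj => by
      by_contra hjl
      exact hj (ind_eq_zero_of_dvd hn (not_le.mp hjl)))
  beta_reduce at h hc
  rw [h, hc, add_zero, add_comm]

/-! ## The sign character and the cast `ℝ → ℂ` -/

/-- `(-1)^{a+b} = (-1)^a (-1)^b` in the `if · = 1` encoding (complex values). -/
theorem sign_add (a b : ZMod 2) :
    (if a + b = 1 then (-1 : ℂ) else 1) =
      (if a = 1 then (-1 : ℂ) else 1) * (if b = 1 then (-1 : ℂ) else 1) := by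
  have key : ∀ u : ZMod 2, u = 0 ∨ u = 1 := by decide
  have h11 : (1 : ZMod 2) + 1 = 0 := by decide
  rcases key a with rfl | rfl <;> rcases key b with rfl | rfl <;> simp [h11]

/-- The real block sum against a `±1` phase is the complex one: `|Σ λ φ| = ‖Σ (λ : ℂ) (φ : ℂ)‖`. -/
theorem abs_block_eq_norm (Φ : ℕ → ZMod 2) (k b : ℕ) :
    |∑ a ∈ range (2 ^ k), ((ArithmeticFunction.liouville (2 ^ k * b + a) : ℤ) : ℝ) *
        (if Φ (2 ^ k * b + a) = 1 then (-1 : ℝ) else 1)| =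
      ‖∑ a ∈ range (2 ^ k), ((ArithmeticFunction.liouville (2 ^ k * b + a) : ℤ) : ℂ) *
        (if Φ (2 ^ k * b + a) = 1 then (-1 : ℂ) else 1)‖ := by
  rw [← Real.norm_eq_abs, ← Complex.norm_real, Complex.ofReal_sum]
  congr 1
  refine Finset.sum_congr rfl fun a _ => ?_
  split_ifs <;> simp

/-! ## Semimultiplicativity of banded phases -/

/-- The complex phase `N ↦ (-1)^{Φ(N)}` of an infinite `s`-banded quadratic form `(quad, lin)`
(`quad i j ≠ 0 → i < j ≤ i + s`; window `range (N+1)`, immaterial by `bitForm_range_eq`) is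
`2`-semimultiplicative with gap `≤ s` in the sense of Konieczny (Definition 3.1). -/
theorem isSemimultiplicative_banded (quad : ℕ → ℕ → ZMod 2) (lin : ℕ → ZMod 2) {s : ℕ}
    (hband : ∀ i j, quad i j ≠ 0 → i < j ∧ j ≤ i + s) :
    IsSemimultiplicative 2 s (fun N : ℕ =>
      if (∑ i ∈ range (N + 1), ∑ j ∈ range (N + 1),
              quad i j * (if Nat.testBit N i then (1 : ZMod 2) else 0) *
                (if Nat.testBit N j then (1 : ZMod 2) else 0)) +
            ∑ i ∈ range (N + 1), lin i * (if Nat.testBit N i then (1 : ZMod 2) else 0) = 1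
        then (-1 : ℂ) else 1) := by
  refine ⟨by simp, fun l n m k hk hm hms hn => ?_⟩
  beta_reduce
  -- a common window `range (n + m + k + 1)` for the four numbers
  rw [bitForm_range_eq quad lin (lt_two_pow_of_le (Nat.le_succ m))
      (lt_two_pow_of_le (show m ≤ n + m + k + 1 by omega)),
    bitForm_range_eq quad lin (lt_two_pow_of_le (Nat.le_succ (n + m)))
      (lt_two_pow_of_le (show n + m ≤ n + m + k + 1 by omega)),
    bitForm_range_eq quad lin (lt_two_pow_of_le (Nat.le_succ (m + k)))
      (lt_two_pow_of_le (show m + k ≤ n + m + k + 1 by omega)),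
    ← sign_add, ← sign_add, form_cocycle (range (n + m + k + 1)) quad lin hband hk hm hms hn]

/-! ## The block statistic from the dichotomy -/

/-- The dichotomy step.  If the complex `±1` phase `f = (-1)^Φ` is `2`-semimultiplicative with gap
`≤ s`, then — given `hA`, `hK1`, `hK2` — the real block statistic of `(-1)^Φ` against `λ` is
`≤ ε 2^n` for `k`, then `n`, large: either some correlation `f(p·) conj f(p'·)` (`p ≠ p'` odd primes)
is not Cesàro-null, then `f` is almost periodic (`Konieczny.isAlmostPeriodic_of_structured`) and `hA`
applies; or all are, then each correlation is `1`-bounded and `2`-quasimultiplicative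
(`Konieczny.isQuasimult_corr`), `hK1` gives its aligned short-block control and `hK2` concludes. -/
theorem blocks_of_semimult
    (hA : ∀ f : ℕ → ℂ, Konieczny.IsAlmostPeriodic f → (∀ m, ‖f m‖ ≤ 1) →
      ∀ ε : ℝ, 0 < ε → ∀ᶠ k : ℕ in atTop, ∀ᶠ n : ℕ in atTop,
        ∑ b ∈ range (2 ^ (n - k)),
          ‖∑ a ∈ range (2 ^ k), ((ArithmeticFunction.liouville (2 ^ k * b + a) : ℤ) : ℂ) *
            f (2 ^ k * b + a)‖ ≤ ε * (2 : ℝ) ^ n)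
    (hK1 : ∀ (S : ℕ) (g : ℕ → ℂ), (∀ m, ‖g m‖ ≤ 1) → Konieczny.IsQuasimult 2 S g →
      Tendsto (fun N : ℕ => (N : ℂ)⁻¹ * ∑ m ∈ range N, g m) atTop (nhds 0) →
      ∀ δ : ℝ, 0 < δ → ∃ l₀ : ℕ, ∀ l : ℕ, l₀ ≤ l → ∀ a : ℕ,
        ‖∑ y ∈ range (2 ^ l), g (a * 2 ^ l + y)‖ ≤ δ * (2 : ℝ) ^ l)
    (hK2 : ∀ f : ℕ → ℂ, (∀ m, ‖f m‖ ≤ 1) →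
      (∀ p₁ p₂ : ℕ, p₁.Prime → p₂.Prime → p₁ ≠ p₂ → 2 < p₁ → 2 < p₂ →
        ∀ δ : ℝ, 0 < δ → ∃ l₀ : ℕ, ∀ l : ℕ, l₀ ≤ l → ∀ a : ℕ,
          ‖∑ y ∈ range (2 ^ l), f (p₁ * (a * 2 ^ l + y)) * starRingEnd ℂ (f (p₂ * (a * 2 ^ l + y)))‖ ≤
            δ * (2 : ℝ) ^ l) →
      ∀ ε : ℝ, 0 < ε → ∀ᶠ k : ℕ in atTop, ∀ᶠ n : ℕ in atTop,
        ∑ b ∈ range (2 ^ (n - k)),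
          ‖∑ a ∈ range (2 ^ k), ((ArithmeticFunction.liouville (2 ^ k * b + a) : ℤ) : ℂ) *
            f (2 ^ k * b + a)‖ ≤ ε * (2 : ℝ) ^ n)
    {s : ℕ} (Φ : ℕ → ZMod 2)
    (hSM : IsSemimultiplicative 2 s (fun N => if Φ N = 1 then (-1 : ℂ) else 1)) :
    ∀ ε : ℝ, 0 < ε → ∀ᶠ k : ℕ in atTop, ∀ᶠ n : ℕ in atTop,
      ∑ b ∈ range (2 ^ (n - k)),
        |∑ a ∈ range (2 ^ k), ((ArithmeticFunction.liouville (2 ^ k * b + a) : ℤ) : ℝ) *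
          (if Φ (2 ^ k * b + a) = 1 then (-1 : ℝ) else 1)| ≤ ε * (2 : ℝ) ^ n := by
  intro ε hε
  set f : ℕ → ℂ := fun N => if Φ N = 1 then (-1 : ℂ) else 1 with hfdef
  have hf1 : ∀ N, ‖f N‖ = 1 := by
    intro N
    simp only [hfdef]
    split_ifs <;> simp
  have hf1' : ∀ N, ‖f N‖ ≤ 1 := fun N => (hf1 N).le
  have h22 : (2 : ℕ) ≤ 2 := le_rfl
  -- the complex block statistic, along Konieczny's dichotomy
  have hC : ∀ᶠ k : ℕ in atTop, ∀ᶠ n : ℕ in atTop, ∑ b ∈ range (2 ^ (n - k)),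
      ‖∑ a ∈ range (2 ^ k), ((ArithmeticFunction.liouville (2 ^ k * b + a) : ℤ) : ℂ) *
        f (2 ^ k * b + a)‖ ≤ ε * (2 : ℝ) ^ n := by
    by_cases hall : ∀ p p' : ℕ, p.Prime → p'.Prime → p ≠ p' → 2 < p → 2 < p' →
        Tendsto (fun N : ℕ => (N : ℂ)⁻¹ * ∑ n ∈ range N, f (p * n) * conj (f (p' * n)))
          atTop (nhds 0)
    · refine hK2 f hf1' (fun p₁ p₂ hp₁ hp₂ hne h₁ h₂ => ?_) ε hε
      have hB₁ : p₁ ≤ 2 ^ (p₁ + p₂) := lt_two_pow_of_le (Nat.le_add_right _ _) |>.le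
      have hB₂ : p₂ ≤ 2 ^ (p₁ + p₂) := lt_two_pow_of_le (Nat.le_add_left _ _) |>.le
      have hg : Konieczny.IsQuasimult 2 (p₁ + p₂ + s) (fun n => f (p₁ * n) * conj (f (p₂ * n))) :=
        Konieczny.isQuasimult_corr h22 hSM hB₁ hB₂
      have hg1 : ∀ m, ‖f (p₁ * m) * conj (f (p₂ * m))‖ ≤ 1 := by
        intro m
        rw [norm_mul, Complex.norm_conj, hf1, hf1, mul_one]
      exact hK1 (p₁ + p₂ + s) _ hg1 hg (hall p₁ p₂ hp₁ hp₂ hne h₁ h₂)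
    · push Not at hall
      obtain ⟨p, p', hp, hp', hne, hqp, hqp', hnot⟩ := hall
      have hs' : 1 ≤ max s 1 := le_max_right _ _
      have hf' : IsSemimultiplicative 2 (max s 1) f := Konieczny.gap_mono h22 (le_max_left _ _) hSM hf1
      have hAP : Konieczny.IsAlmostPeriodic f := by
        rcases lt_or_gt_of_ne hne with h | h
        · exact Konieczny.isAlmostPeriodic_of_structured h22 hs' hf' hf1 hp' hp h hqp
            (fun ht => hnot (Konieczny.tendsto_corr_swap ht))
        · exact Konieczny.isAlmostPeriodic_of_structured h22 hs' hf' hf1 hp hp' h hqp' hnot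
      exact hA f hAP hf1' ε hε
  -- cast back to `ℝ`
  refine hC.mono fun k hk => hk.mono fun n hn => ?_
  refine le_of_eq_of_le (Finset.sum_congr rfl fun b _ => ?_) hn
  exact abs_block_eq_norm Φ k b

/-! ## The stub -/

/-- Stub `stub_momoOfBranches` of `MobiusLadder.QuadraticDigitPhases` (line `Sketch`): the
per-sequence input of the banded branch.  Given (as hypotheses) `hA` — almost periodic `1`-bounded
sequences have dyadic block statistic `≤ ε 2^n` against `λ`; `hK1` — `2`-quasimultiplicative
`1`-bounded Cesàro-null sequences have uniformly small aligned short block sums; `hK2` — pairwise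
short-block control of `f(p₁·) conj f(p₂·)` over odd prime pairs gives the block statistic of `f` — the
phase `(-1)^{Φ(N)}` of every infinite `s`-banded quadratic digit form
`Φ(N) = Σ quad i j xᵢ xⱼ + Σ lin i xᵢ` (`quad i j ≠ 0 → i < j ≤ i + s`, `x` = binary digits of `N`) has
block statistic `Σ_{b<2^(n-k)} |Σ_{a<2^k} λ(2^k b + a) (-1)^{Φ(2^k b + a)}| ≤ ε 2^n` for all large `k` and
then all large `n`.  The phase is `2`-semimultiplicative with gap `≤ s` (`isSemimultiplicative_banded`)
and the tree's Konieczny dichotomy splits into the almost periodic branch (`hA`) and the Kátai branch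
(`hK1`, `hK2`) (`blocks_of_semimult`). -/
theorem stub_momoOfBranches
    (hA : ∀ f : ℕ → ℂ, Literature.NumberTheory.LFunctions.Konieczny.IsAlmostPeriodic f →
      (∀ m, ‖f m‖ ≤ 1) →
      ∀ ε : ℝ, 0 < ε → ∀ᶠ k : ℕ in atTop, ∀ᶠ n : ℕ in atTop,
        ∑ b ∈ range (2 ^ (n - k)),
          ‖∑ a ∈ range (2 ^ k), ((ArithmeticFunction.liouville (2 ^ k * b + a) : ℤ) : ℂ) *
            f (2 ^ k * b + a)‖ ≤ ε * (2 : ℝ) ^ n)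
    (hK1 : ∀ (S : ℕ) (g : ℕ → ℂ), (∀ m, ‖g m‖ ≤ 1) →
      Literature.NumberTheory.LFunctions.Konieczny.IsQuasimult 2 S g →
      Tendsto (fun N : ℕ => (N : ℂ)⁻¹ * ∑ m ∈ range N, g m) atTop (nhds 0) →
      ∀ δ : ℝ, 0 < δ → ∃ l₀ : ℕ, ∀ l : ℕ, l₀ ≤ l → ∀ a : ℕ,
        ‖∑ y ∈ range (2 ^ l), g (a * 2 ^ l + y)‖ ≤ δ * (2 : ℝ) ^ l)
    (hK2 : ∀ f : ℕ → ℂ, (∀ m, ‖f m‖ ≤ 1) →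
      (∀ p₁ p₂ : ℕ, p₁.Prime → p₂.Prime → p₁ ≠ p₂ → 2 < p₁ → 2 < p₂ →
        ∀ δ : ℝ, 0 < δ → ∃ l₀ : ℕ, ∀ l : ℕ, l₀ ≤ l → ∀ a : ℕ,
          ‖∑ y ∈ range (2 ^ l), f (p₁ * (a * 2 ^ l + y)) * starRingEnd ℂ (f (p₂ * (a * 2 ^ l + y)))‖ ≤
            δ * (2 : ℝ) ^ l) →
      ∀ ε : ℝ, 0 < ε → ∀ᶠ k : ℕ in atTop, ∀ᶠ n : ℕ in atTop,
        ∑ b ∈ range (2 ^ (n - k)),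
          ‖∑ a ∈ range (2 ^ k), ((ArithmeticFunction.liouville (2 ^ k * b + a) : ℤ) : ℂ) *
            f (2 ^ k * b + a)‖ ≤ ε * (2 : ℝ) ^ n)
    (s : ℕ) :
    ∀ (quad : ℕ → ℕ → ZMod 2) (lin : ℕ → ZMod 2),
      (∀ i j, quad i j ≠ 0 → i < j ∧ j ≤ i + s) →
      ∀ ε : ℝ, 0 < ε → ∀ᶠ k : ℕ in atTop, ∀ᶠ n : ℕ in atTop,
        ∑ b ∈ range (2 ^ (n - k)),
          |∑ a ∈ range (2 ^ k), ((ArithmeticFunction.liouville (2 ^ k * b + a) : ℤ) : ℝ) *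
            (if (∑ i ∈ range (2 ^ k * b + a + 1), ∑ j ∈ range (2 ^ k * b + a + 1),
                    quad i j * (if Nat.testBit (2 ^ k * b + a) i then (1 : ZMod 2) else 0) *
                      (if Nat.testBit (2 ^ k * b + a) j then (1 : ZMod 2) else 0)) +
                  ∑ i ∈ range (2 ^ k * b + a + 1),
                    lin i * (if Nat.testBit (2 ^ k * b + a) i then (1 : ZMod 2) else 0) = 1
              then (-1 : ℝ) else 1)| ≤ ε * (2 : ℝ) ^ n := by
  intro quad lin hband
  exact blocks_of_semimult hA hK1 hK2
    (fun N => (∑ i ∈ range (N + 1), ∑ j ∈ range (N + 1),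
        quad i j * (if Nat.testBit N i then (1 : ZMod 2) else 0) *
          (if Nat.testBit N j then (1 : ZMod 2) else 0)) +
      ∑ i ∈ range (N + 1), lin i * (if Nat.testBit N i then (1 : ZMod 2) else 0))
    (isSemimultiplicative_banded quad lin hband)

end Summit.QuantumAdvantage.QuantumAdvantage.Theorems.MobiusLadderQuadraticDigitPhasesStubMomoOfBranches
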